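import Summits.CriticalPhenomena.PercolationContinuityZ3.Theorems.PercNearOneGluingNoHeavyLowerTailTformReferenceTransfer
import Summits.CriticalPhenomena.PercolationContinuityZ3.Theorems.PercNearOneGluingNoHeavyLowerTailAttachedChampion
import HarnessLib

/-!
# `NoHeavyLowerTail` (stmt-CriticalPhenomena-4575) — the STAR-PACKING transfer and the typed reduction of the crux to ONE
# observer-free inequality: LIGHT-STAR PACKING (LSP, alias TCS⁺)

Support file (prover `prim-hp-5`, hull-port cell, T-form calculus, gen 3; `--supports stmt-CriticalPhenomena-4575`).
No definitions, no named facts, no sorries.  Notation of `…TformReferenceTransfer`: `μ = prodBernoulli w`, relays `A`,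
observer `o ∉ A`, level `j`, `N = |π(o)|`, `L = {1 ≤ N ≤ j}`, `R_x = {|π(x)| ≤ j}`, `𝔸 = {1 ≤ N}`, `K = G − o` read on
`ω ∩ {e | o ∉ e}` (`~'`, `π'`), `π'(B) = ⋃_{y∈B} π'(y)`, `Φ_K`, `Φ_G`; gates = positive-weight neighbours of `o`.

The reference transfer (`Theorems.tform_of_reference`) proves the T-form `μ(L) ≤ μ(R_c ∩ 𝔸)` from the per-star inequality
`μ(L ∩ σ_B) ≤ μ(R_c ∩ 𝔸 ∩ σ_B) + μ(R_p ∩ σ_B) − μ(R_c ∩ σ_B)`, which for a nonempty star `B` is EQUIVALENT to the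
`K`-inequality ("star packing")

  PST_B(p, c):   μ(p ≁' B, 1 ≤ |π'(B)| ≤ j) + μ(|π'(B)| = 0, |π'(c)| ≤ j) ≤ μ(p ≁' B, |π'(p)| ≤ j),

and discharged it when `B` has a member no `K`-lighter than `p`.  Here the per-star input is made a HYPOTHESIS:

* `tform_of_starPacking` — relays `p, c` with `Φ_K(c) ≤ Φ_K(p)`, `Φ_G(p) ≤ Φ_G(c)` and PST_B(p, c) for every nonempty star
  `B` of `o` ⇒ `μ(L) ≤ μ(R_c ∩ 𝔸)`.
* `attachedChampion_of_lightStarPacking` — **the registered stub `stub_attachedChampion` (XZ at every champion, every observer,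
  every graph) follows from the single observer-free law LSP:** for every weighted graph, relays `A`, level `j`, champion `q`
  (`Φ(a) ≤ Φ(q)` for all `a ∈ A`), relay `c`, and nonempty set `B` of NON-relay vertices,
      `μ(q ≁ B, 1 ≤ |π(B)| ≤ j) + μ(|π(B)| = 0, |π(c)| ≤ j) ≤ μ(q ≁ B, |π(q)| ≤ j)`.            (LSP)
  (Apply `tform_of_starPacking` at `o` with `p` = a champion of `K = G − o`, `c = q` the champion of `G`: both lightness
  hypotheses are automatic, stars with a relay member are `CutObserver.unguardedStability_of_member`, all-Steiner stars are LSP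
  in `K`.)  For `c = q` LSP is exactly the guarded T-form of champion stability at the glued set `B` (TCS of the ttrl census
  `run/shared/lean/ttrl/tcs/README.md`, 0 / 40.9 M); LSP = "TCS⁺" asks the TCS slack to dominate
  `μ(|π(B)| = 0, c light) − μ(|π(B)| = 0, q light)` for every relay `c`.  Census of this seat (`lab/lsp_test.py`, `lab/pst_champ.py`,
  exact): 0 violations / 34 765 (q, c, B) triples + 0 / 2 656 light stars of observers; for `|B| = 1`, LSP is the deficit form
  `slack_y(c) ≥ Φ(c) − Φ(q)` of XZ at the Steiner observer `y` (so LSP is an inductive strengthening of XZ itself).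
* `noHeavyLowerTail_of_lightStarPacking` — LSP ⇒ `NoHeavyLowerTail` (via `Theorems.noHeavyLowerTail_of_attachedChampion`).
-/

noncomputable section

namespace Summit.CriticalPhenomena.PercolationContinuityZ3.Theorems

open MeasureTheory Set Literature.Probability.LatticeModels Literature.Probability.Percolation
open scoped Classical BigOperators

variable {n : ℕ}

open CutObserver KNPreFKG in
/-- **STAR-PACKING TRANSFER.**  Let `o ∉ A`, `p, c ∈ A` with `Φ_K(c) ≤ Φ_K(p)` and `Φ_G(p) ≤ Φ_G(c)`, and suppose that for every
nonempty set `B` of positive-weight neighbours of `o` the star-packing inequality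
`μ(p ≁' B, 1 ≤ |π'(B)| ≤ j) + μ(|π'(B)| = 0, |π'(c)| ≤ j) ≤ μ(p ≁' B, |π'(p)| ≤ j)` holds (events of the configuration off `o`).
Then `μ{1 ≤ N ≤ j} ≤ μ({|π(c)| ≤ j} ∩ {1 ≤ N})`.
[cite: KozmaNitzan2024, Lemma 5 and Thm. 4 (pp. 13–14) — star decomposition] -/
theorem tform_of_starPacking (w : Sym2 (Fin n) → unitInterval) (A : Finset (Fin n)) (o p c : Fin n) (j : ℕ)
    (hoA : o ∉ A) (hpA : p ∈ A) (hcA : c ∈ A)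
    (hPST : ∀ B : Finset (Fin n), B.Nonempty → (∀ y ∈ B, y ≠ o ∧ w s(o, y) ≠ 0) →
      (prodBernoulli w).real {ω : BondConfig (Fin n) |
          (∀ y ∈ B, ¬ (openGraph (ω ∩ {e | o ∉ e})).Reachable p y) ∧
            1 ≤ (A.filter fun z => ∃ y ∈ B, (openGraph (ω ∩ {e | o ∉ e})).Reachable y z).card ∧
            (A.filter fun z => ∃ y ∈ B, (openGraph (ω ∩ {e | o ∉ e})).Reachable y z).card ≤ j} +
        (prodBernoulli w).real {ω : BondConfig (Fin n) |
          ¬ 1 ≤ (A.filter fun z => ∃ y ∈ B, (openGraph (ω ∩ {e | o ∉ e})).Reachable y z).card ∧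
            (A.filter fun z => (openGraph (ω ∩ {e | o ∉ e})).Reachable c z).card ≤ j} ≤
      (prodBernoulli w).real {ω : BondConfig (Fin n) |
          (∀ y ∈ B, ¬ (openGraph (ω ∩ {e | o ∉ e})).Reachable p y) ∧
            (A.filter fun z => (openGraph (ω ∩ {e | o ∉ e})).Reachable p z).card ≤ j})
    (hKc : (prodBernoulli w).real {ω : BondConfig (Fin n) |
          (A.filter fun z => (openGraph (ω ∩ {e | o ∉ e})).Reachable c z).card ≤ j} ≤
        (prodBernoulli w).real {ω : BondConfig (Fin n) |
          (A.filter fun z => (openGraph (ω ∩ {e | o ∉ e})).Reachable p z).card ≤ j})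
    (hG : (prodBernoulli w).real {ω : BondConfig (Fin n) | (A.filter fun z => ω ∈ openConn p z).card ≤ j} ≤
      (prodBernoulli w).real {ω : BondConfig (Fin n) | (A.filter fun z => ω ∈ openConn c z).card ≤ j}) :
    (prodBernoulli w).real {ω : BondConfig (Fin n) |
        1 ≤ (A.filter fun x => ω ∈ openConn o x).card ∧ (A.filter fun x => ω ∈ openConn o x).card ≤ j} ≤
      (prodBernoulli w).real {ω : BondConfig (Fin n) |
        (A.filter fun x => ω ∈ openConn c x).card ≤ j ∧ 1 ≤ (A.filter fun x => ω ∈ openConn o x).card} := by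
  haveI : IsProbabilityMeasure (prodBernoulli w) := inferInstance
  set μ := prodBernoulli w with hμ
  have hpo : p ≠ o := fun h => hoA (h ▸ hpA)
  have hco : c ≠ o := fun h => hoA (h ▸ hcA)
  set R' : BondConfig (Fin n) → Fin n → Fin n → Prop := fun ω x y =>
    (openGraph (ω ∩ {e | o ∉ e})).Reachable x y with hR'
  -- events
  set L := {ω : BondConfig (Fin n) |
    1 ≤ (A.filter fun x => ω ∈ openConn o x).card ∧ (A.filter fun x => ω ∈ openConn o x).card ≤ j} with hL
  set Att := {ω : BondConfig (Fin n) | 1 ≤ (A.filter fun x => ω ∈ openConn o x).card} with hAtt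
  set RcA := {ω : BondConfig (Fin n) |
    (A.filter fun x => ω ∈ openConn c x).card ≤ j ∧ 1 ≤ (A.filter fun x => ω ∈ openConn o x).card} with hRcA
  set Rc := {ω : BondConfig (Fin n) | (A.filter fun z => ω ∈ openConn c z).card ≤ j} with hRc
  set Rp := {ω : BondConfig (Fin n) | (A.filter fun z => ω ∈ openConn p z).card ≤ j} with hRp
  set sW : Fin n → ℝ := fun y => μ.real {ω : BondConfig (Fin n) |
    (A.filter fun z => (openGraph (ω ∩ {e | o ∉ e})).Reachable y z).card ≤ j} with hsW
  change sW c ≤ sW p at hKc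
  change μ.real Rp ≤ μ.real Rc at hG
  -- gates of `o`
  set Γ : Finset (Fin n) := Finset.univ.filter fun v => v ≠ o ∧ w s(o, v) ≠ 0 with hΓ
  have hΓo : o ∉ Γ := by
    rw [hΓ, Finset.mem_filter]; exact fun h => h.2.1 rfl
  have hiso : ∀ v, v ≠ o → v ∉ Γ → w s(o, v) = 0 := by
    intro v hvo hvΓ
    by_contra hne
    exact hvΓ (Finset.mem_filter.2 ⟨Finset.mem_univ _, hvo, hne⟩)
  -- ### the per-star inequality
  have hstar : ∀ B ∈ Γ.powerset,
      μ.real (L ∩ starEvent o ↑B) ≤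
        μ.real (RcA ∩ starEvent o ↑B) + (μ.real (Rp ∩ starEvent o ↑B) - μ.real (Rc ∩ starEvent o ↑B)) := by
    intro B hB
    have hBΓ : B ⊆ Γ := Finset.mem_powerset.1 hB
    have hBo : ∀ y ∈ B, y ≠ o := fun y hy => (Finset.mem_filter.1 (hBΓ hy)).2.1
    rcases B.eq_empty_or_nonempty with rfl | hBne
    · -- #### the empty star
      have h0 : L ∩ starEvent o ↑(∅ : Finset (Fin n)) = (∅ : Set (BondConfig (Fin n))) := by
        ext ω
        simp only [mem_inter_iff, mem_empty_iff_false, iff_false, not_and]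
        intro hLω hσ
        rw [Finset.coe_empty] at hσ
        obtain ⟨x, hx⟩ := Finset.card_pos.1 (lt_of_lt_of_le Nat.zero_lt_one hLω.1)
        rw [Finset.mem_filter] at hx
        exact not_reachable_of_mem_starEvent_empty hσ (fun h => hoA (h ▸ hx.1)) hx.2
      have hRx : ∀ x : Fin n, x ≠ o →
          μ.real ({ω : BondConfig (Fin n) | (A.filter fun z => ω ∈ openConn x z).card ≤ j} ∩
            starEvent o ↑(∅ : Finset (Fin n))) = μ.real (starEvent o ↑(∅ : Finset (Fin n))) * sW x := by
        intro x hxo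
        have hset : {ω : BondConfig (Fin n) | (A.filter fun z => ω ∈ openConn x z).card ≤ j} ∩
            starEvent o ↑(∅ : Finset (Fin n)) =
            starEvent o ↑(∅ : Finset (Fin n)) ∩ {ω : BondConfig (Fin n) |
              (A.filter fun z => (openGraph ((ω ∩ {e | o ∉ e}))).Reachable x z).card ≤ j} := by
          ext ω
          simp only [mem_inter_iff, mem_setOf_eq]
          constructor
          · rintro ⟨h1, h2⟩
            refine ⟨h2, ?_⟩
            rw [Finset.coe_empty] at h2
            rw [← filter_eq_avoid_of_star_empty A h2 hxo]; exact h1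
          · rintro ⟨h2, h1⟩
            refine ⟨?_, h2⟩
            have h2' := h2
            rw [Finset.coe_empty] at h2'
            rw [filter_eq_avoid_of_star_empty A h2' hxo]; exact h1
        rw [hset]
        exact measureReal_starEvent_inter_avoid w o ↑(∅ : Finset (Fin n))
          (fun ξ => (A.filter fun z => (openGraph ξ).Reachable x z).card ≤ j)
      rw [h0, measureReal_empty, hRx p hpo, hRx c hco]
      have h1 : 0 ≤ μ.real (RcA ∩ starEvent o ↑(∅ : Finset (Fin n))) := measureReal_nonneg
      have h2 : 0 ≤ μ.real (starEvent o ↑(∅ : Finset (Fin n))) * (sW p - sW c) :=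
        mul_nonneg measureReal_nonneg (by linarith)
      nlinarith
    · -- #### a nonempty star: packing in `K`
      have hpack := hPST B hBne fun y hy => ⟨hBo y hy, (Finset.mem_filter.1 (hBΓ hy)).2.2⟩
      set S := starEvent o (↑B : Set (Fin n)) with hS
      set V := {ω : BondConfig (Fin n) | (openGraph ω).Reachable p o} with hV
      -- the three `K`-events
      set P1 : BondConfig (Fin n) → Prop := fun ξ =>
        (∀ y ∈ B, ¬ (openGraph ξ).Reachable p y) ∧
          1 ≤ (A.filter fun z => ∃ y ∈ B, (openGraph ξ).Reachable y z).card ∧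
          (A.filter fun z => ∃ y ∈ B, (openGraph ξ).Reachable y z).card ≤ j with hP1
      set P2 : BondConfig (Fin n) → Prop := fun ξ =>
        ¬ 1 ≤ (A.filter fun z => ∃ y ∈ B, (openGraph ξ).Reachable y z).card ∧
          (A.filter fun z => (openGraph ξ).Reachable c z).card ≤ j with hP2
      set P3 : BondConfig (Fin n) → Prop := fun ξ =>
        (∀ y ∈ B, ¬ (openGraph ξ).Reachable p y) ∧ (A.filter fun z => (openGraph ξ).Reachable p z).card ≤ j
        with hP3
      change μ.real {ω | P1 (ω ∩ {e | o ∉ e})} + μ.real {ω | P2 (ω ∩ {e | o ∉ e})} ≤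
        μ.real {ω | P3 (ω ∩ {e | o ∉ e})} at hpack
      -- on S: π(o) = π'(B)
      have hF3 : ∀ ω ∈ S, (A.filter fun x => ω ∈ openConn o x) =
          (A.filter fun z => ∃ y ∈ B, R' ω y z) := by
        intro ω hω
        refine Finset.filter_congr fun x hx => ⟨fun h => ?_, fun h => ?_⟩
        · have hxo : x ≠ o := fun h' => hoA (h' ▸ hx)
          obtain ⟨y, hy, hyx⟩ := exists_avoid_of_reachable_star hω hxo h
          exact ⟨y, Finset.mem_coe.1 hy, hyx⟩
        · obtain ⟨y, hy, hyx⟩ := h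
          exact reachable_of_mem_star hω (hBo y hy) (Finset.mem_coe.2 hy) hyx
      -- off V: π(p) = π'(p), p ≁' B; on S: p ≁' B ⇒ p ≁ o
      have hF4a : ∀ ω, ω ∉ V → (A.filter fun x => ω ∈ openConn p x) = (A.filter fun z => R' ω p z) := by
        intro ω hVω
        refine Finset.filter_congr fun x _ => ⟨fun h => ?_, fun h => reachable_mono inter_subset_left h⟩
        exact reachable_avoiding_of_not_reachable hVω h
      have hF4b : ∀ ω ∈ S, ω ∉ V → ∀ y ∈ B, ¬ R' ω p y := by
        intro ω hω hVω y hy hpy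
        exact hVω ((reachable_of_mem_star hω (hBo y hy) (Finset.mem_coe.2 hy) hpy.symm).symm)
      have hF5 : ∀ ω ∈ S, (∀ y ∈ B, ¬ R' ω p y) → ω ∉ V := by
        intro ω hω hny hVω
        obtain ⟨y, hy, hyp⟩ := exists_avoid_of_reachable_star hω hpo (SimpleGraph.Reachable.symm hVω)
        exact hny y (Finset.mem_coe.1 hy) hyp.symm
      -- (a) L ∩ S ∩ V ⊆ Rp ∩ S ∩ V
      have ha : L ∩ S ∩ V ⊆ Rp ∩ S ∩ V := by
        rintro ω ⟨⟨hLω, hω⟩, hVω⟩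
        refine ⟨⟨?_, hω⟩, hVω⟩
        show (A.filter fun x => ω ∈ openConn p x).card ≤ j
        have heq : (A.filter fun x => ω ∈ openConn p x) = (A.filter fun x => ω ∈ openConn o x) :=
          Finset.filter_congr fun x _ => ⟨fun h => (SimpleGraph.Reachable.symm hVω).trans h, fun h => hVω.trans h⟩
        rw [heq]; exact hLω.2
      -- (b) (L ∩ S) \ V ⊆ S ∩ {P1}
      have hb : (L ∩ S) \ V ⊆ S ∩ {ω | P1 (ω ∩ {e | o ∉ e})} := by
        rintro ω ⟨⟨hLω, hω⟩, hVω⟩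
        refine ⟨hω, ?_⟩
        show P1 (ω ∩ {e | o ∉ e})
        refine ⟨hF4b ω hω hVω, ?_, ?_⟩
        · have := hLω.1; rw [hF3 ω hω] at this; exact this
        · have := hLω.2; rw [hF3 ω hω] at this; exact this
      -- (b') (Rc ∩ S) \ Att ⊆ S ∩ {P2}
      have hb' : (Rc ∩ S) \ Att ⊆ S ∩ {ω | P2 (ω ∩ {e | o ∉ e})} := by
        rintro ω ⟨⟨hRω, hω⟩, hA⟩
        refine ⟨hω, ?_⟩
        show P2 (ω ∩ {e | o ∉ e})
        have hA' : ¬ 1 ≤ (A.filter fun x => ω ∈ openConn o x).card := hA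
        refine ⟨by rw [hF3 ω hω] at hA'; exact hA', ?_⟩
        -- `c` is a relay not joined to `o` (else `N ≥ 1`), so its cluster avoids `o`
        have hco' : ¬ (openGraph ω).Reachable c o := by
          intro h
          exact hA' (Finset.card_pos.2 ⟨c, Finset.mem_filter.2 ⟨hcA, h.symm⟩⟩)
        have heq : (A.filter fun z => ω ∈ openConn c z) = (A.filter fun z => R' ω c z) := by
          refine Finset.filter_congr fun x _ => ⟨fun h => ?_, fun h => reachable_mono inter_subset_left h⟩
          exact reachable_avoiding_of_not_reachable hco' h
        have h := hRω
        change (A.filter fun z => ω ∈ openConn c z).card ≤ j at h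
        rw [heq] at h; exact h
      -- (c) S ∩ {P3} ⊆ (Rp ∩ S) \ V
      have hc : S ∩ {ω | P3 (ω ∩ {e | o ∉ e})} ⊆ (Rp ∩ S) \ V := by
        rintro ω ⟨hω, hRω⟩
        change P3 (ω ∩ {e | o ∉ e}) at hRω
        obtain ⟨hny, hcard⟩ := hRω
        have hVω : ω ∉ V := hF5 ω hω hny
        refine ⟨⟨?_, hω⟩, hVω⟩
        show (A.filter fun x => ω ∈ openConn p x).card ≤ j
        rw [hF4a ω hVω]; exact hcard
      -- (d) independence of the star
      have hd1 : μ.real (S ∩ {ω | P1 (ω ∩ {e | o ∉ e})}) = μ.real S * μ.real {ω | P1 (ω ∩ {e | o ∉ e})} :=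
        measureReal_starEvent_inter_avoid w o ↑B P1
      have hd2 : μ.real (S ∩ {ω | P2 (ω ∩ {e | o ∉ e})}) = μ.real S * μ.real {ω | P2 (ω ∩ {e | o ∉ e})} :=
        measureReal_starEvent_inter_avoid w o ↑B P2
      have hd3 : μ.real (S ∩ {ω | P3 (ω ∩ {e | o ∉ e})}) = μ.real S * μ.real {ω | P3 (ω ∩ {e | o ∉ e})} :=
        measureReal_starEvent_inter_avoid w o ↑B P3
      -- assemble
      have hsplitL := measureReal_inter_add_sdiff (μ := μ) (s := L ∩ S) (MeasurableSet.of_discrete (s := V))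
        (measure_ne_top _ _)
      have hsplitR := measureReal_inter_add_sdiff (μ := μ) (s := Rp ∩ S) (MeasurableSet.of_discrete (s := V))
        (measure_ne_top _ _)
      have hsplitC := measureReal_inter_add_sdiff (μ := μ) (s := Rc ∩ S) (MeasurableSet.of_discrete (s := Att))
        (measure_ne_top _ _)
      have hRcA' : Rc ∩ S ∩ Att = RcA ∩ S := by
        ext ω
        simp only [hRc, hRcA, hAtt, mem_inter_iff, mem_setOf_eq]
        constructor
        · rintro ⟨⟨h1, h2⟩, h3⟩; exact ⟨⟨h1, h3⟩, h2⟩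
        · rintro ⟨⟨h1, h3⟩, h2⟩; exact ⟨⟨h1, h2⟩, h3⟩
      rw [hRcA'] at hsplitC
      have h1 : μ.real (L ∩ S ∩ V) ≤ μ.real (Rp ∩ S ∩ V) := measureReal_mono ha (measure_ne_top _ _)
      have h2 : μ.real ((L ∩ S) \ V) ≤ μ.real S * μ.real {ω | P1 (ω ∩ {e | o ∉ e})} := by
        rw [← hd1]; exact measureReal_mono hb (measure_ne_top _ _)
      have h2' : μ.real ((Rc ∩ S) \ Att) ≤ μ.real S * μ.real {ω | P2 (ω ∩ {e | o ∉ e})} := by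
        rw [← hd2]; exact measureReal_mono hb' (measure_ne_top _ _)
      have h3 : μ.real S * μ.real {ω | P3 (ω ∩ {e | o ∉ e})} ≤ μ.real ((Rp ∩ S) \ V) := by
        rw [← hd3]; exact measureReal_mono hc (measure_ne_top _ _)
      have h4 : μ.real S * (μ.real {ω | P1 (ω ∩ {e | o ∉ e})} + μ.real {ω | P2 (ω ∩ {e | o ∉ e})}) ≤
          μ.real S * μ.real {ω | P3 (ω ∩ {e | o ∉ e})} :=
        mul_le_mul_of_nonneg_left hpack measureReal_nonneg
      have hLsum : μ.real (L ∩ S) = μ.real (L ∩ S ∩ V) + μ.real ((L ∩ S) \ V) := hsplitL.symm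
      have hRsum : μ.real (Rp ∩ S) = μ.real (Rp ∩ S ∩ V) + μ.real ((Rp ∩ S) \ V) := hsplitR.symm
      nlinarith [hsplitC, measureReal_nonneg (μ := μ) (s := S)]
  -- ### summing over the stars
  have hdecL := real_eq_sum_inter_starEvent w Γ o hΓo hiso L
  have hdecA := real_eq_sum_inter_starEvent w Γ o hΓo hiso RcA
  have hdecp := real_eq_sum_inter_starEvent w Γ o hΓo hiso Rp
  have hdecc := real_eq_sum_inter_starEvent w Γ o hΓo hiso Rc
  change μ.real L ≤ μ.real RcA
  rw [hdecL, hdecA]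
  calc ∑ B ∈ Γ.powerset, μ.real (L ∩ starEvent o ↑B)
      ≤ ∑ B ∈ Γ.powerset, (μ.real (RcA ∩ starEvent o ↑B) +
          (μ.real (Rp ∩ starEvent o ↑B) - μ.real (Rc ∩ starEvent o ↑B))) := Finset.sum_le_sum hstar
    _ = ∑ B ∈ Γ.powerset, μ.real (RcA ∩ starEvent o ↑B) +
          (∑ B ∈ Γ.powerset, μ.real (Rp ∩ starEvent o ↑B) - ∑ B ∈ Γ.powerset, μ.real (Rc ∩ starEvent o ↑B)) := by
        rw [Finset.sum_add_distrib, Finset.sum_sub_distrib]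
    _ = ∑ B ∈ Γ.powerset, μ.real (RcA ∩ starEvent o ↑B) + (μ.real Rp - μ.real Rc) := by rw [← hdecp, ← hdecc]
    _ ≤ ∑ B ∈ Γ.powerset, μ.real (RcA ∩ starEvent o ↑B) := by linarith

end Summit.CriticalPhenomena.PercolationContinuityZ3.Theorems

end
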